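import Mathlib.Analysis.Convex.Topology
import Mathlib.Analysis.SpecialFunctions.Exp
import Mathlib.LinearAlgebra.Matrix.Symmetric
import Literature.MathematicalPhysics.QuantumFieldTheory.Balaban1983to89.T4ShellMeasure

/-!
# N21 (NE7c) · ROBUSTNESS LEDGER of the chord and shrink steps: sitewise chord budget (sharp `√#κ`) and per-bond convex
# letters (lens Card 89 ∕ ROW P⁗″)

R134 seat pub-ymgap-dag-n21-d (g8), node N21 = NE7c (single-run shell-weight bound, NOT PRINTED in [Bałaban 1983–89],
NOT proved), lane K3⁷ `SpineGivenEndpointR13SepCoPH` (stmt-QuantumFields-20544, `--kind proof --supports … --as helper`).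
Part 37 of the comparison series.  THIS FILE = §C of the lens's `Sketch-nearmiss-g30.lean` (LENS-nearmiss v30.0∕v31.0 ROW P⁗″, idle
row «any n21 seat») — farm rc 0 · 0 warnings at the lens desk — VERBATIM, statements and proofs, re-homed in this namespace.
AUTHORSHIP OF THE MATHEMATICS: planner seat `ym-lens-BalabanUVNodes-nearmiss` g30 (memo-only seat, lapsed 22:40Z per director-ym
№196; memos stand as records); this seat only files.

WHAT (lens Card 89).  The sitewise chord budget with the sharp `√#κ` (`sitewise_floor`, `chordLedger_sitewise`,
`chordLedger_sharp`) — how much a `G`-Lipschitz non-quadratic part can cost along a chord, site by site — and the shrink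
competitor for PER-BOND CONVEX (non-abelian chart) letters (`shrink_mem_bondwise`): the robustness ledger behind parts 32–36.

HONEST FRAMING.  [textbook] ∕ by-name bookkeeping; 0 def, 0 sorry; nothing of Bałaban's asserted; NE7c NOT PRINTED ∕ NOT proved; N21 NOT
discharged; counts unmoved (typed 28∕28 · discharged 5∕27); count-neutral; one finite 𝕋⁴ at fixed ε — nothing about ℝ⁴ ∕ OS ∕ mass gap ∕ Clay.
-/

open Set Matrix

namespace Summit.QuantumFields.YangMills.Theorems.N21ChordLedger

/-! ## §C  Card 89 — robustness ledger: sitewise chord budget (sharp `√#κ`) and per-bond convex letters -/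
section Ledger

variable {κ : Type*} [Fintype κ] [DecidableEq κ]

omit [Fintype κ] [DecidableEq κ] in
/-- **SITEWISE FLOOR.** `γt² − g|t| ≥ −g²∕(4γ)`. [textbook] -/
theorem sitewise_floor {γ : ℝ} (hγ : 0 < γ) (g t : ℝ) : -(g ^ 2 / (4 * γ)) ≤ γ * t ^ 2 - g * |t| := by
  have h : 0 ≤ (2 * γ * |t| - g) ^ 2 := sq_nonneg _
  have h4 : 0 < 4 * γ := by linarith
  rw [neg_le_iff_add_nonneg, ← sq_abs t]
  have : γ * |t| ^ 2 - g * |t| + g ^ 2 / (4 * γ) = (2 * γ * |t| - g) ^ 2 / (4 * γ) := by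
    field_simp; ring
  linarith [this ▸ div_nonneg h h4.le]

/-- **THE SITEWISE CHORD BUDGET.**  Along a chord with displacement `u`, the quadratic gain `γΣu_b²` against a SITEWISE
gradient loss `Σ g|u_b|` is at least the reading site's term minus `g²∕(4γ)` per other site:
`Σ_b (γu_b² − g|u_b|) ≥ (γu_{b₀}² − g|u_{b₀}|) − (#κ − 1)g²∕(4γ)`.  So the chord certificate of Card 84 in sitewise
currency reads `g·(1 + √#κ) ≲ 2γ·r₀` (`r₀` = the reading distance `|u_{b₀}|`): the `√#κ` is the price of a gradient
bound per site, and it is sharp (`chordLedger_sharp`). [textbook] -/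
theorem chordLedger_sitewise {γ : ℝ} (hγ : 0 < γ) (g : ℝ) (u : κ → ℝ) (b₀ : κ) :
    (γ * u b₀ ^ 2 - g * |u b₀|) - (Fintype.card κ - 1) * (g ^ 2 / (4 * γ))
      ≤ ∑ b, (γ * u b ^ 2 - g * |u b|) := by
  rw [← Finset.add_sum_erase _ _ (Finset.mem_univ b₀)]
  have hcard : ((Finset.univ.erase b₀).card : ℝ) = Fintype.card κ - 1 := by
    rw [Finset.card_erase_of_mem (Finset.mem_univ b₀), Finset.card_univ]
    have : 1 ≤ Fintype.card κ := Fintype.card_pos_iff.2 ⟨b₀⟩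
    push_cast [Nat.cast_sub this]
    ring
  have hrest : -(((Finset.univ.erase b₀).card : ℝ) * (g ^ 2 / (4 * γ)))
      ≤ ∑ b ∈ Finset.univ.erase b₀, (γ * u b ^ 2 - g * |u b|) := by
    have := Finset.card_nsmul_le_sum (Finset.univ.erase b₀) (fun b => γ * u b ^ 2 - g * |u b|)
      (-(g ^ 2 / (4 * γ))) (fun b _ => sitewise_floor hγ g (u b))
    rw [nsmul_eq_mul] at this
    linarith
  rw [hcard] at hrest
  linarith

/-- **SHARPNESS OF THE `√#κ`.**  The adversarial displacement (`r` at the reading site, `g∕(2γ)` everywhere else)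
attains the floor exactly. [textbook] -/
theorem chordLedger_sharp {γ : ℝ} (hγ : 0 < γ) {g : ℝ} (hg : 0 ≤ g) (r : ℝ) (b₀ : κ) :
    ∑ b, (γ * (Function.update (fun _ => g / (2 * γ)) b₀ r b) ^ 2
        - g * |Function.update (fun _ => g / (2 * γ)) b₀ r b|)
      = (γ * r ^ 2 - g * |r|) - (Fintype.card κ - 1) * (g ^ 2 / (4 * γ)) := by
  rw [← Finset.add_sum_erase _ _ (Finset.mem_univ b₀), Function.update_self]
  have hrest : ∑ b ∈ Finset.univ.erase b₀,
      (γ * (Function.update (fun _ => g / (2 * γ)) b₀ r b) ^ 2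
        - g * |Function.update (fun _ => g / (2 * γ)) b₀ r b|)
      = ∑ b ∈ Finset.univ.erase b₀, (-(g ^ 2 / (4 * γ))) := by
    refine Finset.sum_congr rfl fun b hb => ?_
    have hb' : b ≠ b₀ := Finset.ne_of_mem_erase hb
    rw [Function.update_of_ne hb', abs_of_nonneg (by positivity)]
    field_simp
    ring
  rw [hrest, Finset.sum_const, nsmul_eq_mul, Finset.card_erase_of_mem (Finset.mem_univ b₀), Finset.card_univ]
  have : 1 ≤ Fintype.card κ := Fintype.card_pos_iff.2 ⟨b₀⟩
  push_cast [Nat.cast_sub this]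
  ring

omit [Fintype κ] [DecidableEq κ] in
/-- **THE SHRINK COMPETITOR FOR PER-BOND CONVEX LETTERS (non-abelian chart).**  If every bond's letter `K_b ⊂ V` is
convex and contains `0` wherever the weight is non-zero, the bondwise shrink `(1 − tη_b²)•e_b` stays feasible —
g29 `shrink_mem_box` for letters that are convex bodies in `su(N)` per bond (η constant on the `dim G` coordinates of
a bond), so Card 86∕87 apply verbatim to products of per-bond letters. [textbook] -/
theorem shrink_mem_bondwise {V : Type*} [AddCommGroup V] [Module ℝ V] (K : κ → Set V)
    (hK : ∀ b, Convex ℝ (K b)) (e : κ → V) (he : ∀ b, e b ∈ K b) (η : κ → ℝ)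
    (hη : ∀ b, η b ≠ 0 → (0 : V) ∈ K b) {t : ℝ} (ht0 : 0 ≤ t) (ht : ∀ b, t * η b ^ 2 ≤ 1) (b : κ) :
    (1 - t * η b ^ 2) • e b ∈ K b := by
  by_cases hb : η b = 0
  · simp [hb, he b]
  · exact (hK b).smul_mem_of_zero_mem (hη b hb) (he b)
      ⟨by linarith [ht b], by nlinarith [sq_nonneg (η b)]⟩

end Ledger

end Summit.QuantumFields.YangMills.Theorems.N21ChordLedger
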